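import Literature.Probability.LatticeModels.CoarseCellMixingDLR
import Literature.Probability.LatticeModels.CoarseCellMixingCounting
import HarnessLib

/-!
# The Dobrushin–Shlosman block recursion on coarse cells: the chain rule

Third companion ("theorems only") file of
`Literature/Probability/LatticeModels/CoarseCellFiniteSize.lean`. For a specification `γ` read
through cells `cell : V → CoarseIdx μ` and satisfying the good-exterior finite-size condition
`IsGoodFS cell γ good n ε`:

* `multiCell_influence` — the coupling-free chain rule: a single-cell influence bound `δ` valid
  for all cell-union volumes gives `|Y| · δ` for `[0,1]`-valued observables of the cells `Y`
  (condition on one cell at a time and compare a hybrid single-cell observable);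
* `multiCell_influence_of_abs_le` — the same for observables of sup norm `≤ λ` (factor `2λ`).

The base step of the recursion and the exponential decay of boundary influence in the pure case
are in `CoarseCellMixingDecay.lean`, the covariance bound in `CoarseCellMixingPure.lean`, the
quasi-local (leak) case in `CoarseCellMixingLeak.lean`.

## References

* R. L. Dobrushin, S. B. Shlosman, *Constructive criterion for the uniqueness of Gibbs field*
  (1985), §2 (finite-size conditions and the block recursion).
* J. van den Berg, C. Maes, *Disagreement percolation in the study of Markov fields*,
  Ann. Probab. 22 (1994), Thm. 1.
* H.-O. Georgii, *Gibbs Measures and Phase Transitions*, 2nd ed. (de Gruyter 2011), §8.2.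
-/

noncomputable section

open _root_.MeasureTheory
open scoped ENNReal

namespace Literature.Probability.LatticeModels

variable {d : ℕ} {μc : Fin d → ℕ} {V S : Type*} [MeasurableSpace S]

/-- **Multi-cell influence from single-cell influence** (the coupling-free chain rule of the
block recursion): if changing the boundary condition off `Λ` outside the ball of radius `ρ`
around a cell moves the `γ_Λ`-expectation of every `[0,1]`-valued observable of that cell by at
most `δ` (for EVERY cell-union `Λ`), then it moves the expectation of a `[0,1]`-valued observable
of the cells `Y` by at most `|Y| · δ`. Induction on `Y`: condition on one cell `y`
(`γ_Λ = γ_Λ γ_{Λ ∖ y}`, `kernel_integral_integral_eq_of_subset`), freeze `y` inside the inner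
kernel (properness) to get a `(|Y|-1)`-cell observable, and compare the hybrid
`σ ↦ γ_{Λ∖y} H (σ|_Λ ⊕ ζ')` — a single-cell observable of `y` (`DobrushinShlosman.spec_apply_congr`) —
under the two outer kernels. [folklore] -/
theorem multiCell_influence [Fintype V] {cell : V → CoarseIdx μc}
    {γ : Specification V S} (hγ : IsSpecification γ) {ρ : ℕ} {δ : ℝ}
    (hR : ∀ (Λ : Finset V), (∀ v w, cell v = cell w → v ∈ Λ → w ∈ Λ) →
      ∀ (x : CoarseIdx μc) (g : (V → S) → ℝ), Measurable g → (∀ σ, 0 ≤ g σ ∧ g σ ≤ 1) →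
      DependsOn g {v | cell v = x} →
      ∀ ζ ζ' : V → S, (∀ v, v ∉ Λ → cdist x (cell v) ≤ ρ → ζ v = ζ' v) →
        |∫ σ, g σ ∂(γ Λ ζ) - ∫ σ, g σ ∂(γ Λ ζ')| ≤ δ)
    (Y : Finset (CoarseIdx μc)) :
    ∀ (Λ : Finset V), (∀ v w, cell v = cell w → v ∈ Λ → w ∈ Λ) →
      ∀ (H : (V → S) → ℝ), Measurable H → (∀ σ, 0 ≤ H σ ∧ H σ ≤ 1) →
      DependsOn H {v | cell v ∈ Y} →
      ∀ ζ ζ' : V → S, (∀ y ∈ Y, ∀ v, v ∉ Λ → cdist y (cell v) ≤ ρ → ζ v = ζ' v) →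
        |∫ σ, H σ ∂(γ Λ ζ) - ∫ σ, H σ ∂(γ Λ ζ')| ≤ Y.card * δ := by
  classical
  refine Finset.induction_on Y ?_ ?_
  · intro Λ hΛ H hHm hH01 hHdep ζ ζ' hagree
    have hconst : ∀ σ τ, H σ = H τ := fun σ τ =>
      hHdep fun v hv => absurd hv (Finset.notMem_empty _)
    haveI := hγ.isProbability Λ ζ
    haveI := hγ.isProbability Λ ζ'
    have hH : H = fun _ => H ζ := funext fun σ => hconst σ ζ
    rw [hH]
    simp
  · intro y Y' hy IH Λ hΛ H hHm hH01 hHdep ζ ζ' hagree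
    -- remove the cell `y` from the volume
    set Λ₁ : Finset V := Λ.filter fun v => cell v ≠ y with hΛ₁
    have hΛ₁Λ : Λ₁ ⊆ Λ := Finset.filter_subset _ _
    have hΛ₁union : ∀ v w, cell v = cell w → v ∈ Λ₁ → w ∈ Λ₁ := fun v w hvw hv => by
      rw [hΛ₁, Finset.mem_filter] at hv ⊢
      exact ⟨hΛ v w hvw hv.1, hvw ▸ hv.2⟩
    have hH1 : ∀ σ, |H σ| ≤ 1 := fun σ => by rw [abs_of_nonneg (hH01 σ).1]; exact (hH01 σ).2
    have hcons : ∀ η, ∫ σ, H σ ∂(γ Λ η) = ∫ σ, (∫ τ, H τ ∂(γ Λ₁ σ)) ∂(γ Λ η) := fun η =>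
      (kernel_integral_integral_eq_of_subset hγ hΛ₁Λ η hHm hH1).symm
    -- the hybrid glue: `σ` on `Λ`, `ζ'` off `Λ`
    let J : (V → S) → (V → S) := fun σ v => if v ∈ Λ then σ v else ζ' v
    have hJm : Measurable J := by
      refine measurable_pi_iff.2 fun v => ?_
      by_cases hv : v ∈ Λ
      · simp only [J, hv, if_true]
        exact measurable_pi_apply v
      · simp only [J, hv, if_false]
        exact measurable_const
    set G : (V → S) → ℝ := fun σ => ∫ τ, H τ ∂(γ Λ₁ (J σ)) with hG
    have hGm : Measurable G := (DobrushinShlosman.measurable_windowAvg' hγ Λ₁ hHm).comp hJm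
    have hG01 : ∀ σ, 0 ≤ G σ ∧ G σ ≤ 1 := fun σ => by
      haveI := hγ.isProbability Λ₁ (J σ)
      exact integral_mem_unitInterval hHm hH01
    have hG1 : ∀ σ, |G σ| ≤ 1 := fun σ => by rw [abs_of_nonneg (hG01 σ).1]; exact (hG01 σ).2
    have hGdep : DependsOn G {v | cell v = y} := by
      intro σ σ' hσσ'
      simp only [hG]
      rw [DobrushinShlosman.spec_apply_congr hγ Λ₁ (ω := J σ) (η := J σ') ?_]
      intro v hv
      by_cases hvΛ : v ∈ Λ
      · have hvy : cell v = y := by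
          by_contra h
          exact hv (Finset.mem_filter.2 ⟨hvΛ, h⟩)
        simp only [J, hvΛ, if_true]
        exact hσσ' v hvy
      · simp only [J, hvΛ, if_false]
    -- (ii) the hybrid is a single-cell observable of `y`
    have hii : |∫ σ, G σ ∂(γ Λ ζ) - ∫ σ, G σ ∂(γ Λ ζ')| ≤ δ :=
      hR Λ hΛ y G hGm hG01 hGdep ζ ζ' fun v hv hd =>
        hagree y (Finset.mem_insert_self y Y') v hv hd
    -- under `ζ'` the hybrid is the honest inner kernel
    have hG' : ∫ σ, G σ ∂(γ Λ ζ') = ∫ σ, (∫ τ, H τ ∂(γ Λ₁ σ)) ∂(γ Λ ζ') := by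
      refine integral_congr_ae ?_
      filter_upwards [hγ.proper Λ ζ'] with σ hσ
      simp only [hG]
      have hJσ : J σ = σ := funext fun v => by
        by_cases hv : v ∈ Λ
        · simp only [J, hv, if_true]
        · simp only [J, hv, if_false]
          exact (hσ v hv).symm
      rw [hJσ]
    -- (i) under `ζ` the hybrid differs from the honest inner kernel by the induction hypothesis
    have hi : ∀ᵐ σ ∂(γ Λ ζ), |(∫ τ, H τ ∂(γ Λ₁ σ)) - G σ| ≤ Y'.card * δ := by
      filter_upwards [hγ.proper Λ ζ] with σ hσ
      -- freeze the cell `y` at `σ`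
      let Hs : (V → S) → ℝ := fun ω => H (fun v => if cell v = y then σ v else ω v)
      have hfrz : Measurable fun ω : V → S => (fun v => if cell v = y then σ v else ω v) := by
        refine measurable_pi_iff.2 fun v => ?_
        by_cases h : cell v = y
        · simp only [h, if_true]
          exact measurable_const
        · simp only [h, if_false]
          exact measurable_pi_apply v
      have hHsm : Measurable Hs := hHm.comp hfrz
      have hHs01 : ∀ ω, 0 ≤ Hs ω ∧ Hs ω ≤ 1 := fun ω => hH01 _
      have hHsdep : DependsOn Hs {v | cell v ∈ Y'} := by
        intro ω ω' hωω'
        simp only [Hs]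
        apply hHdep
        intro v hv
        by_cases hvy : cell v = y
        · simp only [hvy, if_true]
        · simp only [hvy, if_false]
          have hv' : cell v ∈ insert y Y' := hv
          rcases Finset.mem_insert.1 hv' with h | h
          · exact absurd h hvy
          · exact hωω' v h
      have hfreeze : ∀ η : V → S, (∀ v, cell v = y → η v = σ v) →
          ∫ τ, H τ ∂(γ Λ₁ η) = ∫ τ, Hs τ ∂(γ Λ₁ η) := by
        intro η hη
        refine integral_congr_ae ?_
        filter_upwards [hγ.proper Λ₁ η] with τ hτ
        simp only [Hs]
        congr 1
        funext v
        by_cases hvy : cell v = y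
        · simp only [hvy, if_true]
          have hvΛ₁ : v ∉ Λ₁ := fun h => (Finset.mem_filter.1 h).2 hvy
          rw [hτ v hvΛ₁, hη v hvy]
        · simp only [hvy, if_false]
      have e1 : ∫ τ, H τ ∂(γ Λ₁ σ) = ∫ τ, Hs τ ∂(γ Λ₁ σ) := hfreeze σ fun v _ => rfl
      have e2 : G σ = ∫ τ, Hs τ ∂(γ Λ₁ (J σ)) := by
        simp only [hG]
        refine hfreeze (J σ) fun v hvy => ?_
        by_cases hvΛ : v ∈ Λ
        · simp only [J, hvΛ, if_true]
        · simp only [J, hvΛ, if_false]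
          rw [hσ v hvΛ]
          exact (hagree y (Finset.mem_insert_self _ _) v hvΛ (by rw [hvy, cdist_self]; omega)).symm
      rw [e1, e2]
      refine IH Λ₁ hΛ₁union Hs hHsm hHs01 hHsdep σ (J σ) fun y' hy' v hv hd => ?_
      by_cases hvΛ : v ∈ Λ
      · simp only [J, hvΛ, if_true]
      · simp only [J, hvΛ, if_false]
        rw [hσ v hvΛ]
        exact hagree y' (Finset.mem_insert_of_mem hy') v hvΛ hd
    -- assemble
    haveI := hγ.isProbability Λ ζ
    haveI := hγ.isProbability Λ ζ'
    have hKi : Integrable (fun σ => ∫ τ, H τ ∂(γ Λ₁ σ)) (γ Λ ζ) :=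
      DobrushinMetric.integrable_of_abs_le' (DobrushinShlosman.measurable_windowAvg' hγ Λ₁ hHm)
        (DobrushinShlosman.abs_windowAvg_le' hγ Λ₁ hH1)
    have hGi : Integrable G (γ Λ ζ) := DobrushinMetric.integrable_of_abs_le' hGm hG1
    have hdiff : |∫ σ, (∫ τ, H τ ∂(γ Λ₁ σ)) ∂(γ Λ ζ) - ∫ σ, G σ ∂(γ Λ ζ)| ≤ Y'.card * δ := by
      rw [← integral_sub hKi hGi]
      have h := norm_integral_le_of_norm_le_const (μ := γ Λ ζ) (C := Y'.card * δ)
        (f := fun σ => (∫ τ, H τ ∂(γ Λ₁ σ)) - G σ)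
        (hi.mono fun σ hσ => by rw [Real.norm_eq_abs]; exact hσ)
      simpa using h
    calc |∫ σ, H σ ∂(γ Λ ζ) - ∫ σ, H σ ∂(γ Λ ζ')|
        = |∫ σ, (∫ τ, H τ ∂(γ Λ₁ σ)) ∂(γ Λ ζ) - ∫ σ, G σ ∂(γ Λ ζ')| := by
          rw [hcons ζ, hcons ζ', hG']
      _ ≤ |∫ σ, (∫ τ, H τ ∂(γ Λ₁ σ)) ∂(γ Λ ζ) - ∫ σ, G σ ∂(γ Λ ζ)| +
            |∫ σ, G σ ∂(γ Λ ζ) - ∫ σ, G σ ∂(γ Λ ζ')| := abs_sub_le _ _ _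
      _ ≤ Y'.card * δ + δ := add_le_add hdiff hii
      _ = (insert y Y').card * δ := by
          rw [Finset.card_insert_of_notMem hy]
          push_cast
          ring

/-- **Chain rule for bounded observables**: under the single-cell influence hypothesis of
`multiCell_influence` (influence `≤ δ` at radius `ρ` for every cell-union volume), an observable of
the cells `Y` with sup norm `≤ λ` has influence `≤ 2 λ |Y| δ` (rescale `(H/λ + 1)/2 ∈ [0,1]`).
[folklore] -/
theorem multiCell_influence_of_abs_le [Fintype V] {cell : V → CoarseIdx μc}
    {γ : Specification V S} (hγ : IsSpecification γ) {ρ : ℕ} {δ : ℝ}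
    (hR : ∀ (Λ : Finset V), (∀ v w, cell v = cell w → v ∈ Λ → w ∈ Λ) →
      ∀ (x : CoarseIdx μc) (g : (V → S) → ℝ), Measurable g → (∀ σ, 0 ≤ g σ ∧ g σ ≤ 1) →
      DependsOn g {v | cell v = x} →
      ∀ ζ ζ' : V → S, (∀ v, v ∉ Λ → cdist x (cell v) ≤ ρ → ζ v = ζ' v) →
        |∫ σ, g σ ∂(γ Λ ζ) - ∫ σ, g σ ∂(γ Λ ζ')| ≤ δ)
    (Y : Finset (CoarseIdx μc)) (Λ : Finset V) (hΛ : ∀ v w, cell v = cell w → v ∈ Λ → w ∈ Λ)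
    (H : (V → S) → ℝ) (hHm : Measurable H) {lam : ℝ} (hHb : ∀ σ, |H σ| ≤ lam)
    (hHdep : DependsOn H {v | cell v ∈ Y}) (ζ ζ' : V → S)
    (hagree : ∀ y ∈ Y, ∀ v, v ∉ Λ → cdist y (cell v) ≤ ρ → ζ v = ζ' v) :
    |∫ σ, H σ ∂(γ Λ ζ) - ∫ σ, H σ ∂(γ Λ ζ')| ≤ 2 * lam * (Y.card * δ) := by
  haveI := hγ.isProbability Λ ζ
  haveI := hγ.isProbability Λ ζ'
  have hlam : 0 ≤ lam := (abs_nonneg _).trans (hHb ζ)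
  rcases hlam.eq_or_lt with hlam0 | hlampos
  · have hH0 : ∀ σ, H σ = 0 := fun σ => abs_nonpos_iff.1 (hlam0 ▸ hHb σ)
    have hδ : 0 ≤ (Y.card : ℝ) * δ := by
      have h := multiCell_influence hγ hR Y Λ hΛ (fun _ => 0) measurable_const
        (fun _ => ⟨le_rfl, zero_le_one⟩) (fun _ _ _ => rfl) ζ ζ' hagree
      exact (abs_nonneg _).trans h
    simp only [hH0, integral_zero, sub_self, abs_zero]
    rw [← hlam0]
    simp
  · set Ht : (V → S) → ℝ := fun σ => (H σ / lam + 1) / 2 with hHt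
    have hHtm : Measurable Ht := ((hHm.div_const lam).add_const 1).div_const 2
    have hHt01 : ∀ σ, 0 ≤ Ht σ ∧ Ht σ ≤ 1 := fun σ => by
      have h := hHb σ
      rw [abs_le] at h
      have hlo : -1 ≤ H σ / lam := by rw [le_div_iff₀ hlampos]; linarith [h.1]
      have hhi : H σ / lam ≤ 1 := by rw [div_le_iff₀ hlampos]; linarith [h.2]
      simp only [hHt]
      constructor <;> linarith
    have hHtdep : DependsOn Ht {v | cell v ∈ Y} := fun σ τ hστ => by
      simp only [hHt, hHdep hστ]
    have hM := multiCell_influence hγ hR Y Λ hΛ Ht hHtm hHt01 hHtdep ζ ζ' hagree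
    have hHi : ∀ η, Integrable H (γ Λ η) := fun η => by
      haveI := hγ.isProbability Λ η
      exact DobrushinMetric.integrable_of_abs_le' hHm hHb
    have hlin : ∀ η : V → S, ∫ σ, H σ ∂(γ Λ η) = lam * (2 * ∫ σ, Ht σ ∂(γ Λ η) - 1) := by
      intro η
      haveI := hγ.isProbability Λ η
      have hHti : Integrable Ht (γ Λ η) := DobrushinMetric.integrable_of_abs_le' hHtm (M := 1)
        fun σ => by rw [abs_of_nonneg (hHt01 σ).1]; exact (hHt01 σ).2
      have hH : H = fun σ => lam * (2 * Ht σ - 1) := funext fun σ => by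
        simp only [hHt]; field_simp; ring
      conv_lhs => rw [hH]
      rw [integral_const_mul, integral_sub (hHti.const_mul 2) (integrable_const 1),
        integral_const_mul, integral_const]
      simp
    rw [hlin ζ, hlin ζ', ← mul_sub, abs_mul, abs_of_pos hlampos]
    have e : (2 * ∫ σ, Ht σ ∂(γ Λ ζ) - 1) - (2 * ∫ σ, Ht σ ∂(γ Λ ζ') - 1) =
        2 * (∫ σ, Ht σ ∂(γ Λ ζ) - ∫ σ, Ht σ ∂(γ Λ ζ')) := by ring
    rw [e, abs_mul, abs_of_pos two_pos]
    calc lam * (2 * |∫ σ, Ht σ ∂(γ Λ ζ) - ∫ σ, Ht σ ∂(γ Λ ζ')|) ≤ lam * (2 * (Y.card * δ)) := by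
          gcongr
      _ = 2 * lam * (Y.card * δ) := by ring

end Literature.Probability.LatticeModels
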